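import Literature.Probability.RandomPlanarGeometry.USTPeanoMarkov
import Literature.Probability.LatticeModels.RootedSpanningForestsSplit
import HarnessLib

/-!
# The primal graph of peeling data and its rooted spanning forests ([LSW04] §4.1)

G. F. Lawler, O. Schramm, W. Werner, Ann. Probab. **32** (2004), §4.1, p. 971: "Let `H = H(D)`
denote the subgraph of `ℤ²` whose vertices are the vertices of `α` and `𝒱_D`, and whose edges
are those edges on this set of vertices which do not intersect `β`. … `T ↦ γ(T)` is a bijection
between the set of spanning trees of `H` containing `α` and the set of oriented paths in
`G⃗ ∩ D̄` from `a` to `b` containing `V_P`."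

This file sets up the TREE side of this bijection for the tree's abstract peeling data
(`USTPeanoPeeling.lean`), in a form that survives the peeling recursion:

* `PeelData.pts S = V ∪ {a, b}` (the Peano vertices of `D̄`), `PeelData.inner S` — the primal
  vertices all four of whose Peano corners lie in `pts S` (`𝒱_D`), `PeelData.vH S = α ∪ inner S`
  (the vertices of `H`), `PeelData.amb S` (an ambient finite set of primal indices containing
  every vertex that can occur, stable under peeling);
* `PeelData.EdgeWit S e` — **the edges of `H`**: `e = f₁(p) = [primalNbr p, farP p]` for some
  `p ∈ V ∪ {a}` whose DUAL step is not blocked ("the primal edge alongside an available dual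
  step"; these are the edges of `ℤ²` inside `D̄` not crossing `β`, read off the Manhattan
  lattice), and `PeelData.primalGraph S P₀` — the graph `H` on the finite vertex type `↥P₀` for
  any `P₀ ⊇ amb S`; `PeelData.roots S P₀` — the root set: `α` (wired) together with the
  vertices of `P₀` outside `vH S` (isolated padding vertices);
* `PeelData.Good.mem_vH_of_edgeWit` — edges of `H` join vertices of `H`;
* the forests `Forest (S.primalGraph P₀) (S.roots P₀)` of `RootedSpanningForests.lean` are then
  the spanning trees of `H` containing `α`, oriented towards `α`.

The counting recursion matching `PeelData.card_isPath_eq` and the bijection itself are in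
`USTPeanoTreeCount.lean`.
-/

namespace Literature.Probability.RandomPlanarGeometry

namespace USTPeano

open Literature.Probability.LatticeModels

/-! ### The four Peano corners of a primal vertex -/

/-- **The Peano corners of a primal vertex are a face walk**: the Peano vertices with the same
primal neighbour as `p` are `p`, `stepP p`, `stepP² p`, `stepP³ p`. [folklore] -/
theorem eq_iterate_stepP_of_primalNbr_eq {p c : ℤ × ℤ} (h : primalNbr c = primalNbr p) :
    c = p ∨ c = stepP p ∨ c = stepP (stepP p) ∨ c = stepP (stepP (stepP p)) := by
  obtain ⟨m, n, rfl | rfl | rfl | rfl⟩ := parity_cases p <;>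
    obtain ⟨i, j, rfl | rfl | rfl | rfl⟩ := parity_cases c <;>
      simp only [primalNbr_ee, primalNbr_eo, primalNbr_oe, primalNbr_oo, stepP_ee, stepP_eo,
        stepP_oe, stepP_oo, Prod.mk.injEq] at h ⊢ <;> omega

namespace PeelData

variable (S : PeelData)

/-! ### Vertices -/

/-- The Peano vertices of `D̄`: `V_P = V ∪ {a, b}`. [cite: LawlerSchrammWerner2004, §4.1] -/
def pts : Finset (ℤ × ℤ) := insert S.a (insert S.b S.V)

/-- Membership in `pts`. [folklore] -/
theorem mem_pts {p : ℤ × ℤ} : p ∈ S.pts ↔ p = S.a ∨ p = S.b ∨ p ∈ S.V := by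
  simp [pts]

/-- **The interior primal vertices** `𝒱_D`: those all four of whose Peano corners are Peano
vertices of `D̄`. [cite: LawlerSchrammWerner2004, §4.1] -/
def inner : Finset (ℤ × ℤ) :=
  (S.pts.filter fun p ↦ stepP p ∈ S.pts ∧ stepP (stepP p) ∈ S.pts ∧
    stepP (stepP (stepP p)) ∈ S.pts).image primalNbr

/-- Membership in `inner`: every Peano corner is a Peano vertex of `D̄`. [folklore] -/
theorem mem_inner_iff {v : ℤ × ℤ} : v ∈ S.inner ↔ ∀ c, primalNbr c = v → c ∈ S.pts := by
  rw [inner, Finset.mem_image]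
  constructor
  · rintro ⟨p, hp, rfl⟩ c hc
    rw [Finset.mem_filter] at hp
    rcases eq_iterate_stepP_of_primalNbr_eq hc with rfl | rfl | rfl | rfl
    · exact hp.1
    · exact hp.2.1
    · exact hp.2.2.1
    · exact hp.2.2.2
  · intro h
    obtain ⟨m, n⟩ := v
    refine ⟨(2 * m, 2 * n), Finset.mem_filter.2 ⟨h _ (primalNbr_ee m n), ?_, ?_, ?_⟩,
      primalNbr_ee m n⟩
    · exact h _ (by rw [primalNbr_stepP, primalNbr_ee])
    · exact h _ (by rw [primalNbr_stepP, primalNbr_stepP, primalNbr_ee])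
    · exact h _ (by rw [primalNbr_stepP, primalNbr_stepP, primalNbr_stepP, primalNbr_ee])

/-- **The vertices of `H`**: `α ∪ 𝒱_D`. [cite: LawlerSchrammWerner2004, §4.1] -/
def vH : Finset (ℤ × ℤ) := S.α.toFinset ∪ S.inner

/-- Membership in `vH`. [folklore] -/
theorem mem_vH {v : ℤ × ℤ} : v ∈ S.vH ↔ v ∈ S.α ∨ v ∈ S.inner := by
  simp [vH]

/-- **An ambient set of primal indices**: `α`, the primal neighbours of the Peano vertices of
`D̄` and the far primal vertices of their dual steps; it contains every vertex and every edge
endpoint that can occur along the peeling recursion. [folklore] -/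
def amb : Finset (ℤ × ℤ) := S.α.toFinset ∪ S.pts.image primalNbr ∪ S.pts.image farP

/-- Membership in `amb`. [folklore] -/
theorem mem_amb {v : ℤ × ℤ} :
    v ∈ S.amb ↔ v ∈ S.α ∨ (∃ p ∈ S.pts, primalNbr p = v) ∨ ∃ p ∈ S.pts, farP p = v := by
  simp [amb]

/-- `inner ⊆ primalNbr '' pts`. [folklore] -/
theorem inner_subset_image : S.inner ⊆ S.pts.image primalNbr :=
  Finset.image_subset_image (Finset.filter_subset _ _)

/-- `vH ⊆ amb`. [folklore] -/
theorem vH_subset_amb : S.vH ⊆ S.amb := by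
  intro v hv
  rw [mem_vH] at hv
  rw [amb, Finset.mem_union, Finset.mem_union, List.mem_toFinset]
  rcases hv with hv | hv
  · exact Or.inl (Or.inl hv)
  · exact Or.inl (Or.inr (S.inner_subset_image hv))

/-! ### Edges -/

/-- **The edges of `H`**: the primal edge `f₁(p) = [primalNbr p, farP p]` alongside an available
dual step from a Peano vertex `p ∈ V ∪ {a}` (the dual edge it crosses is not a wall).
[cite: LawlerSchrammWerner2004, §4.1] -/
def EdgeWit (e : Sym2 (ℤ × ℤ)) : Prop :=
  ∃ p, (p = S.a ∨ p ∈ S.V) ∧ ¬ S.Blocked p (stepD p) ∧ e = s(primalNbr p, farP p)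

/-- An edge of `H` is a lattice edge. [folklore] -/
theorem EdgeWit.latticeAdj {S : PeelData} {u v : ℤ × ℤ} (h : S.EdgeWit s(u, v)) : LatticeAdj u v := by
  obtain ⟨p, -, -, he⟩ := h
  rcases Sym2.eq_iff.1 he with ⟨rfl, rfl⟩ | ⟨rfl, rfl⟩
  · exact latticeAdj_primalNbr_farP p
  · exact (latticeAdj_primalNbr_farP p).symm

/-- An edge of `H` has distinct endpoints. [folklore] -/
theorem EdgeWit.ne {S : PeelData} {u v : ℤ × ℤ} (h : S.EdgeWit s(u, v)) : u ≠ v := by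
  obtain ⟨p, -, -, he⟩ := h
  rcases Sym2.eq_iff.1 he with ⟨rfl, rfl⟩ | ⟨rfl, rfl⟩
  · exact (farP_ne_primalNbr p).symm
  · exact farP_ne_primalNbr p

/-- The endpoints of an edge of `H` lie in the ambient set. [folklore] -/
theorem EdgeWit.mem_amb {S : PeelData} {u v : ℤ × ℤ} (h : S.EdgeWit s(u, v)) :
    u ∈ S.amb ∧ v ∈ S.amb := by
  obtain ⟨p, hp, -, he⟩ := h
  have hpts : p ∈ S.pts := by
    rw [mem_pts]
    rcases hp with hp | hp
    · exact Or.inl hp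
    · exact Or.inr (Or.inr hp)
  have h1 : primalNbr p ∈ S.amb := S.mem_amb.2 (Or.inr (Or.inl ⟨p, hpts, rfl⟩))
  have h2 : farP p ∈ S.amb := S.mem_amb.2 (Or.inr (Or.inr ⟨p, hpts, rfl⟩))
  rcases Sym2.eq_iff.1 he with ⟨rfl, rfl⟩ | ⟨rfl, rfl⟩
  · exact ⟨h1, h2⟩
  · exact ⟨h2, h1⟩

/-- **The primal graph `H` of peeling data** on the finite vertex type `↥P₀` (`P₀` an ambient
set of primal indices): `u ~ v` iff `{u, v}` is the primal edge alongside an available dual step.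
[cite: LawlerSchrammWerner2004, §4.1] -/
def primalGraph (P₀ : Finset (ℤ × ℤ)) : SimpleGraph ↥P₀ :=
  SimpleGraph.fromRel fun u v ↦ S.EdgeWit s(u.1, v.1)

/-- Adjacency in the primal graph. [folklore] -/
theorem primalGraph_adj {P₀ : Finset (ℤ × ℤ)} {u v : ↥P₀} :
    (S.primalGraph P₀).Adj u v ↔ u ≠ v ∧ S.EdgeWit s(u.1, v.1) := by
  rw [primalGraph, SimpleGraph.fromRel_adj, Sym2.eq_swap (a := v.1), or_self]

/-- **The root set**: the vertices of `α` (wired) and the padding vertices of `P₀` outside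
`vH S`. [cite: LawlerSchrammWerner2004, §4.1] -/
def roots (P₀ : Finset (ℤ × ℤ)) : Finset ↥P₀ :=
  Finset.univ.filter fun u ↦ u.1 ∈ S.α ∨ u.1 ∉ S.vH

/-- Membership in the root set. [folklore] -/
theorem mem_roots {P₀ : Finset (ℤ × ℤ)} {u : ↥P₀} : u ∈ S.roots P₀ ↔ u.1 ∈ S.α ∨ u.1 ∉ S.vH := by
  simp [roots]

/-- A non-root is an interior vertex of `H` off `α`. [folklore] -/
theorem not_mem_roots {P₀ : Finset (ℤ × ℤ)} {u : ↥P₀} :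
    u ∉ S.roots P₀ ↔ u.1 ∉ S.α ∧ u.1 ∈ S.inner := by
  rw [mem_roots, not_or, not_not, mem_vH]
  constructor
  · rintro ⟨h1, h2⟩
    exact ⟨h1, h2.resolve_left h1⟩
  · rintro ⟨h1, h2⟩
    exact ⟨h1, Or.inr h2⟩

variable {S}

/-! ### Edges join vertices of `H` -/

/-- The primal neighbour of `b` is a vertex of `α` (its last). [folklore] -/
theorem Good.primalNbr_b_mem (h : S.Good) : primalNbr S.b ∈ S.α := by
  rw [← h.lastα]; exact List.getLast_mem _

/-- The primal neighbour of `a` is a vertex of `α` (its first). [folklore] -/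
theorem Good.primalNbr_a_mem (h : S.Good) : primalNbr S.a ∈ S.α := by
  rw [← h.headα]; exact List.head_mem _

/-- **The primal neighbour of a Peano vertex of `V ∪ {a}` is a vertex of `H`**: either one of
the four primal edges at it is a wall (then it lies on `α`), or the clockwise face walk around it
stays in `V ∪ {a, b}` (closure), so all four corners are Peano vertices of `D̄`. [folklore] -/
theorem Good.primalNbr_mem_vH (h : S.Good) {p : ℤ × ℤ} (hp : p = S.a ∨ p ∈ S.V) :
    primalNbr p ∈ S.vH := by
  rw [mem_vH]
  by_cases hα : primalNbr p ∈ S.α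
  · exact Or.inl hα
  right
  -- one step of the face walk: from `c ∈ V ∪ {a}` with the same primal neighbour, `stepP c ∈ V`
  have step : ∀ c, (c = S.a ∨ c ∈ S.V) → primalNbr c = primalNbr p → stepP c ∈ S.V := by
    intro c hc hpc
    have hub : ¬ S.Blocked c (stepP c) := by
      rw [blocked_stepP_iff]
      intro hm
      exact hα (hpc ▸ (mem_of_mem_edgeSet hm).1)
    rcases h.closed c hc _ (manhattan_stepP c) hub with hb | hV
    · have hcb : primalNbr c = primalNbr S.b := by rw [← hb, primalNbr_stepP]
      exact absurd (by rw [← hpc, hcb]; exact h.primalNbr_b_mem) hα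
    · exact hV
  have h1 : stepP p ∈ S.V := step p hp rfl
  have h2 : stepP (stepP p) ∈ S.V := step _ (Or.inr h1) (by rw [primalNbr_stepP])
  have h3 : stepP (stepP (stepP p)) ∈ S.V :=
    step _ (Or.inr h2) (by rw [primalNbr_stepP, primalNbr_stepP])
  rw [mem_inner_iff]
  intro c hc
  rw [mem_pts]
  rcases eq_iterate_stepP_of_primalNbr_eq hc with rfl | rfl | rfl | rfl
  · rcases hp with hp | hp
    · exact Or.inl hp
    · exact Or.inr (Or.inr hp)
  · exact Or.inr (Or.inr h1)
  · exact Or.inr (Or.inr h2)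
  · exact Or.inr (Or.inr h3)

/-- **The far primal vertex of an available dual step is a vertex of `H`.** [folklore] -/
theorem Good.farP_mem_vH (h : S.Good) {p : ℤ × ℤ} (hp : p = S.a ∨ p ∈ S.V)
    (hub : ¬ S.Blocked p (stepD p)) : farP p ∈ S.vH := by
  rcases h.closed p hp _ (manhattan_stepD p) hub with hb | hV
  · rw [farP, hb, mem_vH]
    exact Or.inl h.primalNbr_b_mem
  · exact h.primalNbr_mem_vH (Or.inr hV)

/-- **Edges of `H` join vertices of `H`.** [cite: LawlerSchrammWerner2004, §4.1] -/
theorem Good.mem_vH_of_edgeWit (h : S.Good) {u v : ℤ × ℤ} (he : S.EdgeWit s(u, v)) :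
    u ∈ S.vH ∧ v ∈ S.vH := by
  obtain ⟨p, hp, hub, he⟩ := he
  have h1 := h.primalNbr_mem_vH hp
  have h2 := h.farP_mem_vH hp hub
  rcases Sym2.eq_iff.1 he with ⟨rfl, rfl⟩ | ⟨rfl, rfl⟩
  · exact ⟨h1, h2⟩
  · exact ⟨h2, h1⟩

/-- Padding vertices (outside `vH`) are isolated in `H`. [folklore] -/
theorem Good.not_adj_of_not_mem_vH (h : S.Good) {P₀ : Finset (ℤ × ℤ)} {u : ↥P₀} (hu : u.1 ∉ S.vH)
    (v : ↥P₀) : ¬ (S.primalGraph P₀).Adj u v := fun hadj ↦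
  hu (h.mem_vH_of_edgeWit (S.primalGraph_adj.1 hadj).2).1

/-- A vertex with an edge into it that is a root lies on `α`. [folklore] -/
theorem Good.mem_α_of_adj_of_mem_roots (h : S.Good) {P₀ : Finset (ℤ × ℤ)} {u v : ↥P₀}
    (hadj : (S.primalGraph P₀).Adj u v) (hv : v ∈ S.roots P₀) : v.1 ∈ S.α :=
  ((S.mem_roots).1 hv).resolve_right fun hn ↦ hn (h.mem_vH_of_edgeWit (S.primalGraph_adj.1 hadj).2).2

/-! ### The edge `f₁` at `a` -/

/-- **`f₁ = [α_a, farP a]` is an edge of `H` iff the dual edge `f₂` at `a` is not a wall** (its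
possible witnesses are `a` and `coSrc a`, whose dual steps both cross `f₂`).
[cite: LawlerSchrammWerner2004, §4.1] -/
theorem edgeWit_f₁_iff : S.EdgeWit s(primalNbr S.a, farP S.a) ↔ s(dualNbr S.a, farD S.a) ∉ edgeSet S.β := by
  constructor
  · rintro ⟨p, -, hub, he⟩
    rw [blocked_stepD_iff] at hub
    rcases eq_or_eq_coSrc_of_farP he.symm with rfl | rfl
    · exact hub
    · rwa [dualNbr_coSrc, farD_coSrc, Sym2.eq_swap] at hub
  · intro h2
    exact ⟨S.a, Or.inl rfl, by rwa [blocked_stepD_iff], rfl⟩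

/-! ### Finiteness and the exchange for path counts -/

/-- The Peano paths of the exchanged data are the exchanged Peano paths. [folklore] -/
def isPathSwapEquiv (S : PeelData) : {l // S.swap.IsPath l} ≃ {l // S.IsPath l} where
  toFun γ := ⟨γ.1.map swapIdx, γ.2.of_swap⟩
  invFun γ := ⟨γ.1.map swapIdx, γ.2.swap⟩
  left_inv γ := Subtype.ext (map_swapIdx_map_swapIdx γ.1)
  right_inv γ := Subtype.ext (map_swapIdx_map_swapIdx γ.1)

/-- The exchanged data has as many Peano paths. [folklore] -/
theorem card_isPath_swap (S : PeelData) :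
    Nat.card {l // S.swap.IsPath l} = Nat.card {l // S.IsPath l} :=
  Nat.card_congr (isPathSwapEquiv S)


/-! ### Peeling along the primal step (`peelP`) -/

/-- **Peeling off the first vertex along the primal step** `a → stepP a`: the exchange-conjugate
of `peelE` ([LSW04] Lemma 4.1 with the roles of `α` and `β` exchanged): `V' = V ∖ {stepP a}`,
`a' = stepP a`, `α' = α`, and the dual wall extended by `f₂` (or its dangling first edge dropped).
[cite: LawlerSchrammWerner2004, Lemma 4.1] -/
def peelP (S : PeelData) : PeelData := S.swap.peelE.swap

/-- `peelP` is the exchange of `peelE` of the exchange. [folklore] -/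
theorem peelP_eq (S : PeelData) : S.peelP = S.swap.peelE.swap := rfl

/-- The initial vertex of `peelP`. [folklore] -/
@[simp] theorem peelP_a (S : PeelData) : S.peelP.a = stepP S.a := by
  simp [peelP, swap, peelE]

/-- The final vertex of `peelP`. [folklore] -/
@[simp] theorem peelP_b (S : PeelData) : S.peelP.b = S.b := by
  simp [peelP, swap, peelE]

/-- The primal wall of `peelP` is unchanged. [folklore] -/
@[simp] theorem peelP_α (S : PeelData) : S.peelP.α = S.α := by
  simp [peelP, swap, peelE, Function.comp_def]

/-- The interior vertices of `peelP`. [folklore] -/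
@[simp] theorem mem_peelP_V (S : PeelData) {p : ℤ × ℤ} : p ∈ S.peelP.V ↔ p ≠ stepP S.a ∧ p ∈ S.V := by
  rw [peelP, mem_swap_V, peelE_V, Finset.mem_erase, mem_swap_V, swapIdx_swapIdx, swap_a,
    stepD_swapIdx]
  exact and_congr ⟨fun h e ↦ h (by rw [e]), fun h e ↦ h (swapIdx_injective e)⟩ Iff.rfl

/-- The number of interior vertices drops under `peelP`. [folklore] -/
theorem Good.card_peelP_lt (h : S.Good) (hE : S.swap.CanE) (hb : stepD S.swap.a ≠ S.swap.b) :
    S.peelP.V.card < S.V.card := by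
  rw [peelP, card_swap_V, ← card_swap_V (S := S)]
  exact h.swap.card_peelE_lt hE hb

/-- `peelP` of good data is good. [cite: LawlerSchrammWerner2004, Lemma 4.1] -/
theorem Good.peelP_good (h : S.Good) (hE : S.swap.CanE) (hb : stepD S.swap.a ≠ S.swap.b) : S.peelP.Good :=
  (h.swap.peelE hE hb).swap

/-- The Peano paths of `peelP` are as many as those of `peelE` of the exchange. [folklore] -/
theorem card_isPath_peelP (S : PeelData) :
    Nat.card {l // S.peelP.IsPath l} = Nat.card {l // S.swap.peelE.IsPath l} :=
  card_isPath_swap _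

/-- The dual-wall edges of `peelP` other than `f₂` are those of `β`. [folklore] -/
theorem Good.mem_edgeSet_peelP_β_iff (h : S.Good) (hE : S.swap.CanE) {x y : ℤ × ℤ}
    (hne : s(x, y) ≠ s(dualNbr S.a, farD S.a)) : s(x, y) ∈ edgeSet S.peelP.β ↔ s(x, y) ∈ edgeSet S.β := by
  have key := h.swap.mem_edgeSet_peelE_iff hE (e := s(swapIdx x, swapIdx y)) (by
    rw [swap_a, primalNbr_swapIdx, farP_swapIdx]
    intro he
    apply hne
    have := congrArg (Sym2.map swapIdx) he
    simpa using this)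
  have e1 : s(x, y) = s(swapIdx (swapIdx x), swapIdx (swapIdx y)) := by simp
  rw [PeelData.peelP, swap_β]
  conv_lhs => rw [e1, mem_edgeSet_map_swapIdx, key, swap_α, mem_edgeSet_map_swapIdx]

/-- In the prepend case of `peelP` (`farD a ∉ β`), `f₂` is a dual-wall edge of `peelP`.
[folklore] -/
theorem Good.f₂_mem_edgeSet_peelP_β (h : S.Good) (hn : farD S.a ∉ S.β) :
    s(dualNbr S.a, farD S.a) ∈ edgeSet S.peelP.β := by
  have hn' : farP S.swap.a ∉ S.swap.α := by
    rw [swap_a, farP_swapIdx, swap_α, List.mem_map_of_injective swapIdx_injective]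
    exact hn
  have e : S.peelP.β = farD S.a :: S.β := by
    rw [PeelData.peelP, swap_β, peelE_α_of_notMem hn', List.map_cons, swap_a, farP_swapIdx, swapIdx_swapIdx,
      swap_α, map_swapIdx_map_swapIdx]
  obtain ⟨l, hβ⟩ := h.β_eq_cons
  rw [e, hβ, edgeSet_cons_cons, Sym2.eq_swap]
  exact List.mem_cons_self

/-! ### The vertex sets after peeling -/

/-- After peeling, the Peano vertices of `D̄` are the old ones minus `a` (dual step). [folklore] -/
theorem Good.pts_peelE (h : S.Good) (hE : S.CanE) (hb : stepD S.a ≠ S.b) : S.peelE.pts = S.pts.erase S.a := by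
  have haV := h.stepD_mem_V hE hb
  ext p
  simp only [mem_pts, peelE_a, peelE_b, peelE_V, Finset.mem_erase]
  constructor
  · rintro (rfl | rfl | ⟨-, hp⟩)
    · exact ⟨fun e ↦ h.a_notMem (e ▸ haV), Or.inr (Or.inr haV)⟩
    · exact ⟨Ne.symm h.a_ne_b, Or.inr (Or.inl rfl)⟩
    · exact ⟨fun e ↦ h.a_notMem (e ▸ hp), Or.inr (Or.inr hp)⟩
  · rintro ⟨hpa, rfl | rfl | hp⟩
    · exact absurd rfl hpa
    · exact Or.inr (Or.inl rfl)
    · by_cases hps : p = stepD S.a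
      · exact Or.inl hps
      · exact Or.inr (Or.inr ⟨hps, hp⟩)

/-- After peeling, the Peano vertices of `D̄` are the old ones minus `a` (primal step). [folklore] -/
theorem Good.pts_peelP (h : S.Good) (hE : S.swap.CanE) (hb : stepD S.swap.a ≠ S.swap.b) :
    S.peelP.pts = S.pts.erase S.a := by
  have haV : stepP S.a ∈ S.V := by
    have := h.swap.stepD_mem_V hE hb
    rwa [swap_a, stepD_swapIdx, mem_swap_V, swapIdx_swapIdx] at this
  ext p
  simp only [mem_pts, peelP_a, peelP_b, mem_peelP_V, Finset.mem_erase]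
  constructor
  · rintro (rfl | rfl | ⟨-, hp⟩)
    · exact ⟨fun e ↦ h.a_notMem (e ▸ haV), Or.inr (Or.inr haV)⟩
    · exact ⟨Ne.symm h.a_ne_b, Or.inr (Or.inl rfl)⟩
    · exact ⟨fun e ↦ h.a_notMem (e ▸ hp), Or.inr (Or.inr hp)⟩
  · rintro ⟨hpa, rfl | rfl | hp⟩
    · exact absurd rfl hpa
    · exact Or.inr (Or.inl rfl)
    · by_cases hps : p = stepP S.a
      · exact Or.inl hps
      · exact Or.inr (Or.inr ⟨hps, hp⟩)

/-- Erasing `a` from the Peano vertices erases `α_a` from the interior primal vertices.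
[folklore] -/
theorem inner_eq_of_pts_eq {S S' : PeelData} (hpts : S'.pts = S.pts.erase S.a) :
    S'.inner = S.inner.erase (primalNbr S.a) := by
  ext v
  rw [mem_inner_iff, Finset.mem_erase, mem_inner_iff, hpts]
  constructor
  · intro hv
    refine ⟨fun e ↦ ?_, fun c hc ↦ Finset.mem_of_mem_erase (hv c hc)⟩
    have := hv S.a e.symm
    simp at this
  · rintro ⟨hv, hv'⟩ c hc
    rw [Finset.mem_erase]
    exact ⟨fun e ↦ hv (by rw [← hc, e]), hv' c hc⟩

/-- **Case A** (dual step, `farP a ∉ α`): the vertices of `H` are unchanged. [folklore] -/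
theorem Good.vH_peelE_of_notMem (h : S.Good) (hE : S.CanE) (hb : stepD S.a ≠ S.b) (hn : farP S.a ∉ S.α) :
    S.peelE.vH = S.vH := by
  have hv₀ : farP S.a ∈ S.vH := h.farP_mem_vH (Or.inl rfl) (by rw [blocked_stepD_iff]; exact hE.1)
  ext v
  rw [mem_vH, mem_vH, peelE_α_of_notMem hn, inner_eq_of_pts_eq (h.pts_peelE hE hb), List.mem_cons,
    Finset.mem_erase]
  constructor
  · rintro ((rfl | hv) | ⟨-, hv⟩)
    · exact (S.mem_vH).1 hv₀
    · exact Or.inl hv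
    · exact Or.inr hv
  · rintro (hv | hv)
    · exact Or.inl (Or.inr hv)
    · by_cases e : v = primalNbr S.a
      · exact Or.inl (Or.inr (e ▸ h.primalNbr_a_mem))
      · exact Or.inr ⟨e, hv⟩

/-- **Case A**: the roots of the peeled data are the old roots and `farP a`. [folklore] -/
theorem Good.mem_roots_peelE_of_notMem (h : S.Good) (hE : S.CanE) (hb : stepD S.a ≠ S.b)
    (hn : farP S.a ∉ S.α) {P₀ : Finset (ℤ × ℤ)} {u : ↥P₀} :
    u ∈ S.peelE.roots P₀ ↔ u.1 = farP S.a ∨ u ∈ S.roots P₀ := by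
  rw [mem_roots, mem_roots, h.vH_peelE_of_notMem hE hb hn, peelE_α_of_notMem hn, List.mem_cons, or_assoc]

/-- **Case B** (dual step along the dangling first edge of `α`): the vertices of `H` lose `α_a`.
[folklore] -/
theorem Good.vH_peelE_of_eq (h : S.Good) (hE : S.CanE) (hb : stepD S.a ≠ S.b) {t : List (ℤ × ℤ)}
    (ht : S.α = primalNbr S.a :: farP S.a :: t) : S.peelE.vH = S.vH.erase (primalNbr S.a) := by
  have hnd := h.nodupα
  rw [ht] at hnd
  have hu₀ : primalNbr S.a ∉ farP S.a :: t := (List.nodup_cons.1 hnd).1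
  have h1 : farP S.a ≠ primalNbr S.a := farP_ne_primalNbr _
  have h2 : primalNbr S.a ∉ t := fun h' ↦ hu₀ (List.mem_cons_of_mem _ h')
  ext v
  simp only [mem_vH, Finset.mem_erase, peelE_α_of_eq ht, inner_eq_of_pts_eq (h.pts_peelE hE hb), ht,
    List.mem_cons]
  constructor
  · rintro ((rfl | hv) | ⟨hne, hv⟩)
    · exact ⟨h1, Or.inl (Or.inr (Or.inl rfl))⟩
    · exact ⟨fun e ↦ h2 (e ▸ hv), Or.inl (Or.inr (Or.inr hv))⟩
    · exact ⟨hne, Or.inr hv⟩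
  · rintro ⟨hne, (rfl | rfl | hv) | hv⟩
    · exact absurd rfl hne
    · exact Or.inl (Or.inl rfl)
    · exact Or.inl (Or.inr hv)
    · exact Or.inr ⟨hne, hv⟩

/-- **Case B**: the root set is unchanged. [folklore] -/
theorem Good.roots_peelE_of_eq (h : S.Good) (hE : S.CanE) (hb : stepD S.a ≠ S.b) {t : List (ℤ × ℤ)}
    (ht : S.α = primalNbr S.a :: farP S.a :: t) (P₀ : Finset (ℤ × ℤ)) :
    S.peelE.roots P₀ = S.roots P₀ := by
  ext u
  simp only [mem_roots, h.vH_peelE_of_eq hE hb ht, peelE_α_of_eq ht, Finset.mem_erase, not_and_or,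
    not_not, ht, List.mem_cons]
  tauto

/-- **Primal step**: the vertices of `H` are unchanged. [folklore] -/
theorem Good.vH_peelP (h : S.Good) (hE : S.swap.CanE) (hb : stepD S.swap.a ≠ S.swap.b) :
    S.peelP.vH = S.vH := by
  ext v
  rw [mem_vH, mem_vH, peelP_α, inner_eq_of_pts_eq (h.pts_peelP hE hb), Finset.mem_erase]
  constructor
  · rintro (hv | ⟨-, hv⟩)
    · exact Or.inl hv
    · exact Or.inr hv
  · rintro (hv | hv)
    · exact Or.inl hv
    · by_cases e : v = primalNbr S.a
      · exact Or.inl (e ▸ h.primalNbr_a_mem)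
      · exact Or.inr ⟨e, hv⟩

/-- **Primal step**: the root set is unchanged. [folklore] -/
theorem Good.roots_peelP (h : S.Good) (hE : S.swap.CanE) (hb : stepD S.swap.a ≠ S.swap.b)
    (P₀ : Finset (ℤ × ℤ)) : S.peelP.roots P₀ = S.roots P₀ := by
  ext u
  rw [mem_roots, mem_roots, h.vH_peelP hE hb, peelP_α]

/-! ### The edges after peeling -/

/-- **Dual step**: the edges of the peeled data are the old edges witnessed from `V` (the
witness `a` is gone, the blocking of dual steps is unchanged). [folklore] -/
theorem Good.edgeWit_peelE_iff (h : S.Good) (hE : S.CanE) (hb : stepD S.a ≠ S.b) {e : Sym2 (ℤ × ℤ)} :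
    S.peelE.EdgeWit e ↔ ∃ p ∈ S.V, ¬ S.Blocked p (stepD p) ∧ e = s(primalNbr p, farP p) := by
  have haV := h.stepD_mem_V hE hb
  simp only [EdgeWit, peelE_a, peelE_V, Finset.mem_erase, blocked_stepD_iff, peelE_β]
  constructor
  · rintro ⟨p, hp, hub, rfl⟩
    refine ⟨p, ?_, hub, rfl⟩
    rcases hp with rfl | ⟨-, hp⟩
    · exact haV
    · exact hp
  · rintro ⟨p, hp, hub, rfl⟩
    refine ⟨p, ?_, hub, rfl⟩
    by_cases hps : p = stepD S.a
    · exact Or.inl hps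
    · exact Or.inr ⟨hps, hp⟩

/-- **Primal step**: the edges of the peeled data are the old edges witnessed from `V ∖ {coSrc a}`
(the witness `a` is gone, and in the prepend case the dual step of `coSrc a` is now blocked by
`f₂`; in the dangling case `coSrc a ∉ V`). [folklore] -/
theorem Good.edgeWit_peelP_iff (h : S.Good) (hE : S.swap.CanE) (hb : stepD S.swap.a ≠ S.swap.b)
    {e : Sym2 (ℤ × ℤ)} :
    S.peelP.EdgeWit e ↔ ∃ p ∈ S.V, p ≠ coSrc S.a ∧ ¬ S.Blocked p (stepD p) ∧ e = s(primalNbr p, farP p) := by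
  have haV : stepP S.a ∈ S.V := by
    have := h.swap.stepD_mem_V hE hb
    rwa [swap_a, stepD_swapIdx, mem_swap_V, swapIdx_swapIdx] at this
  -- the blocking of dual steps in `peelP`, for vertices of `V` other than `coSrc a`
  have hbl : ∀ p ∈ S.V, p ≠ coSrc S.a →
      (S.peelP.Blocked p (stepD p) ↔ S.Blocked p (stepD p)) := by
    intro p hp hpc
    rw [blocked_stepD_iff, blocked_stepD_iff]
    refine h.mem_edgeSet_peelP_β_iff hE fun he ↦ ?_
    rcases eq_or_eq_coSrc_of_farD he with rfl | rfl
    · exact h.a_notMem hp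
    · exact hpc rfl
  -- the co-source is either blocked in `peelP` or outside `V`
  have hco : coSrc S.a ∈ S.V → S.peelP.Blocked (coSrc S.a) (stepD (coSrc S.a)) := by
    intro hc
    rw [blocked_stepD_iff, dualNbr_coSrc, farD_coSrc, Sym2.eq_swap]
    rcases (canE_swap_iff.1 hE).2 with hn | ⟨t, ht⟩
    · exact h.f₂_mem_edgeSet_peelP_β hn
    · exfalso
      have ht' : S.swap.α = primalNbr S.swap.a :: farP S.swap.a :: t.map swapIdx := by
        simp [ht]
      have := h.swap.coSrc_notMem hE ht'
      rw [swap_a, coSrc_swapIdx, mem_swap_V, swapIdx_swapIdx] at this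
      exact this hc
  simp only [EdgeWit, peelP_a, mem_peelP_V]
  constructor
  · rintro ⟨p, hp, hub, rfl⟩
    have hpV : p ∈ S.V := by
      rcases hp with rfl | ⟨-, hp⟩
      · exact haV
      · exact hp
    have hpc : p ≠ coSrc S.a := fun e ↦ hub (e ▸ hco (e ▸ hpV))
    exact ⟨p, hpV, hpc, (hbl p hpV hpc).not.1 hub, rfl⟩
  · rintro ⟨p, hp, hpc, hub, rfl⟩
    refine ⟨p, ?_, (hbl p hp hpc).not.2 hub, rfl⟩
    by_cases hps : p = stepP S.a
    · exact Or.inl hps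
    · exact Or.inr ⟨hps, hp⟩

/-- The old edges other than `f₁`, as witnessed from `V ∖ {coSrc a}`. [folklore] -/
theorem Good.edgeWit_and_ne_f₁_iff (h : S.Good) {e : Sym2 (ℤ × ℤ)} :
    (S.EdgeWit e ∧ e ≠ s(primalNbr S.a, farP S.a)) ↔
      ∃ p ∈ S.V, p ≠ coSrc S.a ∧ ¬ S.Blocked p (stepD p) ∧ e = s(primalNbr p, farP p) := by
  constructor
  · rintro ⟨⟨p, hp, hub, rfl⟩, hne⟩
    rcases hp with rfl | hp
    · exact absurd rfl hne
    · refine ⟨p, hp, fun e ↦ hne ?_, hub, rfl⟩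
      rw [e, primalNbr_coSrc, farP_coSrc, Sym2.eq_swap]
  · rintro ⟨p, hp, hpc, hub, rfl⟩
    refine ⟨⟨p, Or.inr hp, hub, rfl⟩, fun he ↦ ?_⟩
    rcases eq_or_eq_coSrc_of_farP he with rfl | rfl
    · exact h.a_notMem hp
    · exact hpc rfl

end PeelData


end USTPeano

end Literature.Probability.RandomPlanarGeometry
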